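import Summits.CriticalPhenomena.CardyFormulaZ2.Theorems.CardyComplexConeParafermionToSLESixFamiliesDiamondDefs
import Summits.CriticalPhenomena.CardyFormulaZ2.Theorems.CardyComplexConeParafermionToSLESixFamiliesDiamondIdentifyAssembly
import HarnessLib

/-!
# Vocabulary of line `potential-darboux-picard-diamond`, part 2 (reshape r3): crux `ParafermionToSLESixFamilies` (stmt-CriticalPhenomena-11389)

Second definitions module of the line (the first, `…DiamondDefs.lean`, p137545/p140645, is at the 400-line limit): the two typed
statements introduced by the lead's reshape r3 after wave 2 — `BoundaryIdentification` (S4v, pure complex analysis, verbatim the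
first hypothesis of the landed assembly `potentialConformalLimit_of_identify`, p144695) and `FreeSideTurnCount` (S1t, lattice, the
S1′ worker's exact remaining lemma after the landed winding toolkit), and the registered glue `identifyPotentialPh_of_boundaryIdentification`
(S4v closes S4′ through the landed assembly — which also certifies that `BoundaryIdentification` is its hypothesis verbatim). NOTHING ELSE is asserted. Sources as in `…DiamondDefs.lean`.
-/

noncomputable section

namespace Summit.CriticalPhenomena.CardyFormulaZ2.Cruxes.ParafermionToSLESixFamilies.PotentialDarbouxPicardDiamond

open scoped Topology NNReal ENNReal BigOperators
open Filter MeasureTheory Set Metric Complex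
open UpperHalfPlane (upperHalfPlaneSet)
open Literature.Probability Literature.Probability.LatticeModels Literature.Probability.Percolation
open Literature.Probability.LatticeModels.DiscreteDobrushin
open Literature.Probability.RandomPlanarGeometry
open Summit.CriticalPhenomena.CardyFormulaZ2.Cruxes.ParafermionToSLESixFamilies.IicTraceFluxPairing

/-! ## Reshape r3 of the line (lead c5, after wave 2; statements only, nothing asserted)

Wave 2 CLOSED S1v (`stub_vertexRelationArcA`, p142298) and reduced S4′ to ONE typed statement of pure complex analysis
(`potentialConformalLimit_of_identify`, p144695: `BoundaryIdentification → S1′ → S2 → S3 → PotentialConformalLimit`) and S1′ to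
ONE typed lattice statement (`FreeSideTurnCount`: the winding of the exploration at the touch darts of a straight free side of the
diamond is configuration-independent — reduced by the landed toolkit `MedialExploration{Prefix,Escape,Vertex,Side}Winding`,
p143201/p144598/p145204/p145413, to the construction of the outside escape staircase) plus assembly. Both become registered stubs
of skeleton r3 (S4v `stub_boundaryIdentification`, S1t `stub_freeSideTurnCount`); S1″ `stub_exactPotentialTracePh2 :
FreeSideTurnCount → ExactPotentialTracePh` replaces S1′ (its former hypothesis `VertexRelationArcA` is now a theorem). -/

/-- **S4v — BOUNDARY IDENTIFICATION** (pure complex analysis; VERBATIM the first hypothesis `hIdent` of the landed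
`potentialConformalLimit_of_identify`, p144695): a conformal map `G` of a marked diamond `D` onto the interior of a compact convex
polygon `K`, continuous and injective up to the boundary data below, which moves weakly monotonically along unit directions `d_j`
on the `N` oriented boundary pieces `[ℓ(t_j), ℓ(t_{j+1})]` (corners and marks are break points; geometric turns `0` or `π/2`,
direction turns `⅔·(geometric turn) + π/3·[mark]`, both summing to `2π` over a period), satisfies `(G′)³ = cst · ψ′/ψ` on `D`
with ONE constant `cst ≠ 0` for EVERY chordal uniformizer `φ` (`ψ = φ⁻¹`). Intended proof: Schwarz reflection of `G` across each
open piece (straight ↦ straight) gives `arg G′ = arg d_j − (piece angle)` there; with `arg (ψ/ψ′) = (piece angle) [+ π on the arc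
where `Re log ψ` decreases]` the function `H = (G′)³ ψ/ψ′` has constant argument on `∂D` off the break points, is bounded near them
(local exponents, `deriv_schwarzReflection_ne_zero_of_im_pos` p140174), hence constant by `HarmonicMaxPrincipleExceptional`;
`identify_allUniformizers_of_one` (p138807) passes from one uniformizer to all. -/
def BoundaryIdentification : Prop :=
    ∀ (D : DobrushinDomain), IsMarkedDiamond D → ∀ (N : ℕ) (ℓ : ℝ → ℂ) (t : ℕ → ℝ) (G : ℂ → ℂ) (d : ℕ →
      ℂ) (K : Set ℂ), 0 < N → Continuous ℓ → (∀ s : ℝ, ℓ (s + 2 * Real.pi) = ℓ s) → Set.range ℓ = frontier D.carrier →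
      Set.InjOn ℓ (Set.Ico 0 (2 * Real.pi)) → t 0 = 0 → (∀ j, t j < t (j + 1)) → (∀ j, t (j + N) = t j + 2 * Real.pi) →
      (∀ j, IsBdrySegment D (ℓ (t j)) (ℓ (t (j + 1)))) → (∀ (j : ℕ) (s : ℝ), t j ≤ s → s ≤ t (j + 1) →
      ℓ s = ℓ (t j) + (((s - t j) / (t (j + 1) - t j) : ℝ) : ℂ) * (ℓ (t (j + 1)) - ℓ (t j))) → ‖d 0‖ = 1 →
      (∀ j, d (j + 1) = d j * Complex.exp ((((2 / 3 : ℝ) * ((ℓ (t (j + 2)) - ℓ (t (j + 1))) / (ℓ (t (j + 1)) - ℓ (t j))).arg + Real.pi / 3 * markInd D (ℓ (t (j + 1)))) : ℝ) * Complex.I)) →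
      (∀ j, ((ℓ (t (j + 2)) - ℓ (t (j + 1))) / (ℓ (t (j + 1)) - ℓ (t j))).arg = 0 ∨ ((ℓ (t (j + 2)) - ℓ (t (j + 1))) / (ℓ (t (j + 1)) - ℓ (t j))).arg = Real.pi / 2) →
      ∑ j ∈ Finset.range N, ((ℓ (t (j + 2)) - ℓ (t (j + 1))) / (ℓ (t (j + 1)) - ℓ (t j))).arg = 2 * Real.pi →
      (∀ j, (2 / 3 : ℝ) * ((ℓ (t (j + 2)) - ℓ (t (j + 1))) / (ℓ (t (j + 1)) - ℓ (t j))).arg + Real.pi / 3 * markInd D (ℓ (t (j + 1))) = Real.pi / 3 ∨ (2 / 3 : ℝ) * ((ℓ (t (j + 2)) - ℓ (t (j + 1))) / (ℓ (t (j + 1)) - ℓ (t j))).arg + Real.pi / 3 * markInd D (ℓ (t (j + 1))) = 2 * Real.pi / 3) →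
      ∑ j ∈ Finset.range N, ((2 / 3 : ℝ) * ((ℓ (t (j + 2)) - ℓ (t (j + 1))) / (ℓ (t (j + 1)) - ℓ (t j))).arg + Real.pi / 3 * markInd D (ℓ (t (j + 1)))) = 2 * Real.pi →
      ContinuousOn G (closure D.carrier) → DifferentiableOn ℂ G D.carrier → Set.InjOn G D.carrier →
      K = convexHull ℝ (Set.range fun j => G (ℓ (t j))) → IsCompact K → Convex ℝ K → (interior K).Nonempty →
      G '' D.carrier = interior K → (∀ z ∈ frontier D.carrier, G z ∈ frontier K) → (∀ (j : ℕ) (s s' : ℝ), t j ≤ s →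
      s ≤ s' → s' ≤ t (j + 1) → ∃ r : ℝ, 0 ≤ r ∧ G (ℓ s') - G (ℓ s) = r * d j) →
      ∃ cst : ℂ, cst ≠ 0 ∧ ∀ φ : ConformalEquiv upperHalfPlaneSet D.carrier, D.IsChordalUniformizing φ →
      ∀ w ∈ D.carrier, deriv G w ^ 3 = cst * (deriv (fun x : ℂ => φ.symm x) w / φ.symm w)

/-- **S1t — CONFIGURATION-INDEPENDENT WINDING AT THE TOUCH DARTS OF A STRAIGHT FREE SIDE** (lattice; the one remaining
un-assembled input of S1′ after wave 2, stated by the S1′ worker; numerically exact in wave 1's enumeration). Along an admissible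
family of a marked diamond, for every oriented free boundary segment `[p, q]` and trim `η > 0`, eventually in `δ`: there are a
corner index `j` and an integer `T` such that whenever the exploration of `Λ δ` (corner orbit of `bcBondConfig ω` from the start
corner, before the exit time) sits at a corner `(u, j)` with `u` within `3δ` of the segment, `η`-away from its endpoints, off the
free arc, and `u + cornerUnit (j+1)` ON the free arc (a touch dart), its turn count is `T`. Reduced (p145204 `turnCount` of a
forbidden vertex path back to `e_a`, p145413 side unification/detour identity) to constructing the outside escape staircase of
`Λ δ` from the touch site back to the outer corner of the face across `e_a`. -/
def FreeSideTurnCount : Prop :=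
  ∀ (D : DobrushinDomain), IsMarkedDiamond D → ∀ (Λ : ℝ → DiscreteDobrushin), IsFamily D Λ → ∀ p q : ℂ,
    IsBdrySegment D p q → segment ℝ p q ⊆ D.arc 1 → ∀ η : ℝ, 0 < η → ∀ᶠ δ in 𝓝[>] (0:ℝ),
      ∀ hδ : (Λ δ).IsZdAdmissible, ∃ (j : Fin 4) (T : ℤ), ∀ u : Site 2,
        infDist (meshPoint δ u) (segment ℝ p q) ≤ 3 * δ → η ≤ dist (meshPoint δ u) p → η ≤ dist (meshPoint δ u) q →
        u ∉ (Λ δ).zdArcB → u + cornerUnit (j + 1) ∈ (Λ δ).zdArcB →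
        ∀ (ω : BondConfig (Site 2)) (t : ℕ), t < exitTime hδ ω →
          cornerOrbit ((Λ δ).bcBondConfig ω) (startCorner hδ) t = (u, j) →
          turnCount ((Λ δ).bcBondConfig ω) (startCorner hδ) t = T

/-- **Glue (registered): S4v closes S4′.** `BoundaryIdentification` is verbatim the first hypothesis of the landed assembly
`potentialConformalLimit_of_identify` (p144695), so the registered stub `stub_identifyPotentialPh` follows from `stub_boundaryIdentification`. -/
theorem identifyPotentialPh_of_boundaryIdentification : BoundaryIdentification → ExactPotentialTracePh →
    (DarbouxPicardConvex ∧ TraceWindingNonneg) → ClosedPrecompactness → PotentialConformalLimit :=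
  fun h => potentialConformalLimit_of_identify h

end Summit.CriticalPhenomena.CardyFormulaZ2.Cruxes.ParafermionToSLESixFamilies.PotentialDarbouxPicardDiamond

end
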